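import Summits.ValiantsHypothesis.ValiantsHypothesis.Theorems.LacunarySymmetroidMatrixDescartesCensusV19CCheck
import Summits.ValiantsHypothesis.ValiantsHypothesis.Theorems.LacunarySymmetroidMatrixDescartesCensusV20Model

/-!
# `MatrixDescartes` census — semantics of the CASE-C (`V = 19`, one-collision) certificate checker (definitions)

HONEST FRAMING.  Object-search cell `pub-symmetroid`; door-A item `DoorA26 = PosRootLawAt 2 6 19`
(stmt-ValiantsHypothesis-19979; OPEN, typed, never asserted) and its sharper support rows `PosRootLawOn 2 6 18 d`.  DEFINITIONS ONLY:
the real-valued semantics of the checker `…CensusV19CCheck` — the real sign of a slot (`0` for the branch's zero atom, else `∓1`),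
well-formedness of rows over the `22` slots and of a cell context, and the `Model` of a cell: everything a hypothetical pencil with
`19` distinct positive det-roots on a one-collision support supplies in the cell `(d, s, branch)` it realises (positive slot magnitudes,
the signed atom valuation, the Newton-cone rows on the `20` sums, the branch's LINK rows, the Gram inequalities `G3, RCS, W ≥ 0`, no odd
definite triangle, no odd triangle through a null letter).  Values of terms / polynomials / monomials / factored rationals and the
entry-level atoms `qv / bv / aval`, `pdet` are those of `…CensusV20Model`.  The proofs (`…CensusV19CSound*`) show that a model refutes every
accepted certificate and that a nineteen yields a model.  Nothing here bears on the `2`-Sidon supports, on `ζ_sym(2,6)` over all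
supports, on `MatrixDescartes` (stmt-ValiantsHypothesis-18050) or on `VP ≠ VNP`.

[folklore] Bookkeeping; elementary.
-/

-- the D-0017 layout repeats a namespace component (single-conjunct summit); the `dupNamespace` linter flags it; name mandated.
set_option linter.dupNamespace false

namespace Summit.ValiantsHypothesis.ValiantsHypothesis.Theorems.LacunarySymmetroidMatrixDescartes.Census.V19C

open V20 (Atom allAtoms psum posOf qA cA Term PolySpec posl FNat fval Row rowC25 rowOne rowAmgm FRat negAt
  G3poly RCSpoly Wpoly tval pval lprod xpow frval BPos)

/-! ## Signs and well-formedness -/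

/-- Real sign attached to a slot of a cell: `0` for the branch's zero atom, `−1` for a negative slot, `1` otherwise. [folklore] -/
noncomputable def sgR (c : Ctx) (k : ℕ) : ℝ :=
  if zeroSlot c.br k then 0 else if negSlot c.s c.br c.pstar k then -1 else 1

/-- A row is well formed over the `22` slots: every position is a slot and all constant bases are positive. [folklore] -/
def RowWF (r : Row) : Prop :=
  (∀ p ∈ r.L, p < 22) ∧ (∀ p ∈ r.R, p < 22) ∧ (∀ be ∈ r.Bnum, 0 < be.1) ∧ (∀ be ∈ r.Bden, 0 < be.1)

/-- What the abstract soundness layer needs of a cell context: every atom has a slot `< 22`, and `p⋆ < 20`. [folklore] -/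
structure Ctx.WF (c : Ctx) : Prop where
  /-- atoms have slots `< 22` -/
  slot_lt : ∀ a ∈ allAtoms, c.slot a < 22
  /-- the collided position is one of the `20` -/
  pstar_lt : c.pstar < 20

/-! ## The model of a cell -/

/-- What a hypothetical pencil with `19` distinct positive det-roots supplies in the cell `c = (d, s, branch)` it realises: positive
slot magnitudes `x`, the signed atom valuation `v` (zero atom `↦ 0`), the Newton-cone rows on the `20` sums, the branch's LINK rows,
the Gram inequalities, and the two triangle facts. [folklore] -/
structure Model (c : Ctx) (x : ℕ → ℝ) (v : Atom → ℝ) : Prop where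
  /-- the context is well formed -/
  wf : c.WF
  /-- slot magnitudes are positive -/
  xpos : ∀ t, 0 < x t
  /-- atoms evaluate to signed slot magnitudes -/
  hv : ∀ a ∈ allAtoms, v a = sgR c (c.slot a) * x (c.slot a)
  /-- Newton-cone rows through positions `t − 1, t, t + 1` of the `20` sums -/
  c25 : ∀ t, 1 ≤ t → t ≤ 18 → (rowC25 c.E t).Holds x
  /-- the branch's LINK rows -/
  link : ∀ sm f lg, linkOK c.br sm f lg = true → (rowLink c.pstar sm f lg).Holds x
  /-- `G3 ≥ 0` -/
  g3 : ∀ i j k, i < j → j < k → k < 6 → 0 ≤ pval v (G3poly i j k)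
  /-- `RCS ≥ 0` for a definite first letter -/
  rcs : ∀ i j, i < 6 → j < 6 → i ≠ j → 0 < v (qA i) → 0 ≤ pval v (RCSpoly i j)
  /-- `W ≥ 0` -/
  w : ∀ i j k l, i < 6 → j < 6 → k < 6 → l < 6 → i ≠ j → i ≠ k → i ≠ l → j ≠ k → j ≠ l → k < l →
    0 ≤ pval v (Wpoly i j k l)
  /-- no odd definite triangle -/
  tri : ∀ i j k, i < j → j < k → k < 6 → 0 < v (qA i) → 0 < v (qA j) → 0 < v (qA k) →
    0 < v (cA i j) * v (cA j k) * v (cA i k)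
  /-- no odd triangle through a null letter `n` and definite letters `a, b` (edge `β(n,b) ≠ 0`) -/
  triNull : ∀ n a b, n < 6 → a < b → b < 6 → n ≠ a → n ≠ b → v (qA n) = 0 → 0 < v (qA a) → 0 < v (qA b) →
    v (cA n b) ≠ 0 → 0 < v (cA n a) * v (cA a b) * v (cA n b)

end Summit.ValiantsHypothesis.ValiantsHypothesis.Theorems.LacunarySymmetroidMatrixDescartes.Census.V19C
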